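import Literature.AlgebraicGeometry.Pohlmann1968.HodgeClassesProductSpanCMProducts
import Literature.AlgebraicGeometry.HodgeTheory.HodgeClassesProductSpanTransport
import Literature.AlgebraicGeometry.HodgeTheory.HodgeConjectureIsogenyInvariance
import Literature.NumberTheory.ComplexMultiplication.SlotwiseIndependentOfLinearlyDisjoint
import HarnessLib

/-!
# Hodge classes on `X × Y` for CM products: isogenous factors and linearly disjoint coefficient fields

Family `hodge`, layer `Literature/AlgebraicGeometry/Pohlmann1968`; consequences file of
`Pohlmann1968/HodgeClassesProductSpanCMProducts` (cell `pub-hodgecm2`, COR-CM, count-neutral own-lane brick of seat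
b25).  Theorems only; no definition, no named fact, no `sorry`.

* `hodgeConjectureFor_prod_biproduct_of_blockwiseIndependent` — **HC(`⨁ A_i`) ∧ HC(`⨁ A'_j`) ⟹ HC(product)**
  (the tree's `hodgeConjectureFor_prod_of_productSpan`: exterior products of algebraic classes are algebraic);
* `hodgeClassesProductSpan_of_isIsogenous_biproduct`, `hodgeConjectureFor_prod_of_isIsogenous_biproduct` — the
  theorem and its HC corollary for `X`, `Y` merely ISOGENOUS to the CM products `⨁ A_i`, `⨁ A'_j` (isogeny invariance
  of `HodgeClassesProductSpan`, the tree's `HodgeClassesProductSpan.of_isIsogenous`);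
* `blockwiseIndependent_of_linearDisjoint` — FIELD-THEORETIC CRITERION for blockwise independence: finite-dimensional
  `L₁, L₂ ≤ ℂ` containing the embeddings of the `K_i`, resp. `K'_j`, and linearly disjoint over `ℚ` (the tree's
  `exists_ringEquiv_apply_eq_of_linearDisjoint`: `a ⊗ b ↦ τ(a)·b` on `L₁ ⊗ L₂ ≅ L₁·L₂`, extended to `ℂ`);
  `…_normalClosure` — with the composita of the Galois closures; `…_of_normalClosure_inf_eq_bot` — trivial
  intersection of these (Galois) composita suffices;
* `hodgeConjectureFor_prod_of_isIsogenous_biproduct_of_normalClosure_inf_eq_bot` — **the Hodge conjecture is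
  multiplicative across CM products whose Galois closures meet trivially**: HC(`X`) ∧ HC(`Y`) ⟹ HC(`X × Y`).

## References
* [MoonenZarhin1999LowDim] B. Moonen, Yu. Zarhin, Math. Ann. 315 (1999), §3 (3.1).
* [Lang2002] S. Lang, *Algebra*, GTM 211, VI §1 Thm. 1.14, V §2 Thm. 2.8, VIII §3–§4.
* [vanGeemen1994HodgeAV] B. van Geemen, LNM 1594 (1994), §3.5–3.7 (isogenies).
-/

noncomputable section

open CategoryTheory CategoryTheory.Limits NumberField

namespace Literature.AlgebraicGeometry.Pohlmann1968

open Literature.AlgebraicGeometry.Motives (AbelianVariety CMType)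
open Literature.AlgebraicGeometry.HodgeTheory
open Literature.AlgebraicGeometry.ComplexMultiplication (IsCMTypeRealisation)

section Consequences

variable {n m : ℕ} {K : Fin n → Type} {K' : Fin m → Type}
  [∀ i, Field (K i)] [∀ i, NumberField (K i)] [∀ j, Field (K' j)] [∀ j, NumberField (K' j)]
  {Φ : ∀ i, CMType (K i)} {Φ' : ∀ j, CMType (K' j)}
  {A : Fin n → AbelianVariety ℂ} {A' : Fin m → AbelianVariety ℂ}
  {ι : ∀ i, 𝓞 (K i) →+* End (A i)} {ι' : ∀ j, 𝓞 (K' j) →+* End (A' j)}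
  {θ : ∀ i, K i →+* Module.End ℂ (complexBetti (A i).X 1)}
  {θ' : ∀ j, K' j →+* Module.End ℂ (complexBetti (A' j).X 1)}

/-- **HC(`⨁ A_i`) ∧ HC(`⨁ A'_j`) ⟹ HC(`(⨁ A_i) × (⨁ A'_j)`)** for CM products with blockwise independent Galois
action (`hodgeConjectureFor_prod_of_productSpan`: exterior products of algebraic classes are algebraic).
[cite: MoonenZarhin1999LowDim, §3 (3.1)] [cite: VoisinHodgeII2003, proof of Prop. 9.20 (first display)] -/
theorem hodgeConjectureFor_prod_biproduct_of_blockwiseIndependent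
    (hA : ∀ i, IsCMTypeRealisation (Φ i) (A i) (ι i) (θ i))
    (hA' : ∀ j, IsCMTypeRealisation (Φ' j) (A' j) (ι' j) (θ' j))
    (hind : ∀ τ : ℂ ≃+* ℂ, ∃ τ₁ : ℂ ≃+* ℂ,
      (∀ (i : Fin n) (s : K i →+* ℂ), (τ₁ : ℂ →+* ℂ).comp s = (τ : ℂ →+* ℂ).comp s) ∧
      ∀ (j : Fin m) (t : K' j →+* ℂ), (τ₁ : ℂ →+* ℂ).comp t = t)
    (hHX : HodgeConjectureFor (⨁ A).dim (⨁ A).X) (hHY : HodgeConjectureFor (⨁ A').dim (⨁ A').X) :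
    HodgeConjectureFor ((⨁ A).prod (⨁ A')).dim ((⨁ A).prod (⨁ A')).X :=
  hodgeConjectureFor_prod_of_productSpan _ _
    (hodgeClassesProductSpan_biproduct_of_blockwiseIndependent hA hA' hind) hHX hHY

/-- **Isogenous factors**: for `X` isogenous to `⨁ A_i` and `Y` isogenous to `⨁ A'_j` (blockwise independent Galois
action), `HodgeClassesProductSpan X Y` (isogeny invariance of the predicate,
`HodgeClassesProductSpan.of_isIsogenous`). [cite: MoonenZarhin1999LowDim, §3 (3.1)] [cite: vanGeemen1994HodgeAV, §3.6 (p. 236)] -/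
theorem hodgeClassesProductSpan_of_isIsogenous_biproduct
    (hA : ∀ i, IsCMTypeRealisation (Φ i) (A i) (ι i) (θ i))
    (hA' : ∀ j, IsCMTypeRealisation (Φ' j) (A' j) (ι' j) (θ' j))
    (hind : ∀ τ : ℂ ≃+* ℂ, ∃ τ₁ : ℂ ≃+* ℂ,
      (∀ (i : Fin n) (s : K i →+* ℂ), (τ₁ : ℂ →+* ℂ).comp s = (τ : ℂ →+* ℂ).comp s) ∧
      ∀ (j : Fin m) (t : K' j →+* ℂ), (τ₁ : ℂ →+* ℂ).comp t = t)
    {X Y : AbelianVariety ℂ} (hXi : AbelianVariety.IsIsogenous X (⨁ A))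
    (hYi : AbelianVariety.IsIsogenous Y (⨁ A')) : HodgeClassesProductSpan X Y :=
  (hodgeClassesProductSpan_biproduct_of_blockwiseIndependent hA hA' hind).of_isIsogenous hXi hYi

/-- **HC(`X`) ∧ HC(`Y`) ⟹ HC(`X × Y`)** for `X`, `Y` isogenous to CM products `⨁ A_i`, `⨁ A'_j` with blockwise
independent Galois action. [cite: MoonenZarhin1999LowDim, §3 (3.1)] [cite: vanGeemen1994HodgeAV, §3.5–3.7 Lemma 3.7 (p. 236)] -/
theorem hodgeConjectureFor_prod_of_isIsogenous_biproduct
    (hA : ∀ i, IsCMTypeRealisation (Φ i) (A i) (ι i) (θ i))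
    (hA' : ∀ j, IsCMTypeRealisation (Φ' j) (A' j) (ι' j) (θ' j))
    (hind : ∀ τ : ℂ ≃+* ℂ, ∃ τ₁ : ℂ ≃+* ℂ,
      (∀ (i : Fin n) (s : K i →+* ℂ), (τ₁ : ℂ →+* ℂ).comp s = (τ : ℂ →+* ℂ).comp s) ∧
      ∀ (j : Fin m) (t : K' j →+* ℂ), (τ₁ : ℂ →+* ℂ).comp t = t)
    {X Y : AbelianVariety ℂ} (hXi : AbelianVariety.IsIsogenous X (⨁ A))
    (hYi : AbelianVariety.IsIsogenous Y (⨁ A')) (hHX : HodgeConjectureFor X.dim X.X)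
    (hHY : HodgeConjectureFor Y.dim Y.X) : HodgeConjectureFor (X.prod Y).dim (X.prod Y).X :=
  hodgeConjectureFor_prod_of_productSpan X Y (hodgeClassesProductSpan_of_isIsogenous_biproduct hA hA' hind hXi hYi)
    hHX hHY

omit [∀ i, NumberField (K i)] [∀ j, NumberField (K' j)] in
/-- **Linearly disjoint coefficient fields give blockwise independence.**  If finite-dimensional `L₁, L₂ ≤ ℂ`
contain every complex embedding of the `K_i`, resp. of the `K'_j`, and are linearly disjoint over `ℚ`, then every
`τ ∈ Aut(ℂ)` agrees on all `Hom(K_i, ℂ)` with an automorphism fixing all `Hom(K'_j, ℂ)` (the tree's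
`exists_ringEquiv_apply_eq_of_linearDisjoint`: `a ⊗ b ↦ τ(a) b` on `L₁ ⊗ L₂ ≅ L₁ L₂`, extended to `ℂ`).
[cite: Lang2002, VI §1 Thm. 1.14 and V §2 Thm. 2.8] -/
theorem blockwiseIndependent_of_linearDisjoint (L₁ L₂ : IntermediateField ℚ ℂ)
    [FiniteDimensional ℚ L₁] [FiniteDimensional ℚ L₂]
    (hK : ∀ (i : Fin n) (s : K i →+* ℂ) (x : K i), s x ∈ L₁)
    (hK' : ∀ (j : Fin m) (t : K' j →+* ℂ) (y : K' j), t y ∈ L₂) (H : L₁.LinearDisjoint L₂) :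
    ∀ τ : ℂ ≃+* ℂ, ∃ τ₁ : ℂ ≃+* ℂ,
      (∀ (i : Fin n) (s : K i →+* ℂ), (τ₁ : ℂ →+* ℂ).comp s = (τ : ℂ →+* ℂ).comp s) ∧
      ∀ (j : Fin m) (t : K' j →+* ℂ), (τ₁ : ℂ →+* ℂ).comp t = t := by
  intro τ
  obtain ⟨τ₁, h1, h2⟩ :=
    Literature.NumberTheory.ComplexMultiplication.exists_ringEquiv_apply_eq_of_linearDisjoint H τ
  exact ⟨τ₁, fun i s => RingHom.ext fun x => h1 _ (hK i s x), fun j t => RingHom.ext fun y => h2 _ (hK' j t y)⟩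

/-- **Galois closures**: blockwise independence holds as soon as the compositum of the Galois closures of the `K_i` in
`ℂ` is linearly disjoint over `ℚ` from that of the `K'_j` (e.g. trivial intersection, both being Galois).
[cite: Lang2002, VI §1 Thm. 1.14] -/
theorem blockwiseIndependent_of_linearDisjoint_normalClosure
    (H : (⨆ i, IntermediateField.normalClosure ℚ (K i) ℂ).LinearDisjoint ↥(⨆ j, IntermediateField.normalClosure ℚ (K' j) ℂ)) :
    ∀ τ : ℂ ≃+* ℂ, ∃ τ₁ : ℂ ≃+* ℂ,
      (∀ (i : Fin n) (s : K i →+* ℂ), (τ₁ : ℂ →+* ℂ).comp s = (τ : ℂ →+* ℂ).comp s) ∧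
      ∀ (j : Fin m) (t : K' j →+* ℂ), (τ₁ : ℂ →+* ℂ).comp t = t :=
  blockwiseIndependent_of_linearDisjoint _ _
    (fun i s x => (le_iSup (fun i => IntermediateField.normalClosure ℚ (K i) ℂ) i : IntermediateField.normalClosure ℚ (K i) ℂ ≤ _)
      (Literature.NumberTheory.ComplexMultiplication.apply_mem_normalClosure i s x))
    (fun j t y => (le_iSup (fun j => IntermediateField.normalClosure ℚ (K' j) ℂ) j : IntermediateField.normalClosure ℚ (K' j) ℂ ≤ _)
      (Literature.NumberTheory.ComplexMultiplication.apply_mem_normalClosure j t y)) H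

/-- **Trivial intersection of the composita of Galois closures suffices** (a compositum of Galois extensions is
Galois, and for a Galois field linear disjointness is trivial intersection, Mathlib
`IntermediateField.LinearDisjoint.of_inf_eq_bot`). [cite: Lang2002, VI §1 Thm. 1.14] -/
theorem blockwiseIndependent_of_normalClosure_inf_eq_bot
    (H : (⨆ i, IntermediateField.normalClosure ℚ (K i) ℂ) ⊓ (⨆ j, IntermediateField.normalClosure ℚ (K' j) ℂ) = ⊥) :
    ∀ τ : ℂ ≃+* ℂ, ∃ τ₁ : ℂ ≃+* ℂ,
      (∀ (i : Fin n) (s : K i →+* ℂ), (τ₁ : ℂ →+* ℂ).comp s = (τ : ℂ →+* ℂ).comp s) ∧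
      ∀ (j : Fin m) (t : K' j →+* ℂ), (τ₁ : ℂ →+* ℂ).comp t = t := by
  have hgal : ∀ i, IsGalois ℚ (IntermediateField.normalClosure ℚ (K i) ℂ) := fun i =>
    Literature.NumberTheory.ComplexMultiplication.isGalois_normalClosure_complex (K := K) i
  haveI : Normal ℚ (⨆ i, IntermediateField.normalClosure ℚ (K i) ℂ : IntermediateField ℚ ℂ) :=
    @IntermediateField.normal_iSup ℚ ℂ _ _ _ (Fin n) (fun i => IntermediateField.normalClosure ℚ (K i) ℂ)
      (fun i => @IsGalois.to_normal _ _ _ _ _ (hgal i))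
  haveI hG : IsGalois ℚ (⨆ i, IntermediateField.normalClosure ℚ (K i) ℂ : IntermediateField ℚ ℂ) :=
    isGalois_iff.2 ⟨inferInstance, inferInstance⟩
  exact blockwiseIndependent_of_linearDisjoint_normalClosure
    (@IntermediateField.LinearDisjoint.of_inf_eq_bot ℚ ℂ _ _ _ _ _ hG inferInstance inferInstance H)

/-- **The Hodge conjecture is multiplicative across CM products with linearly disjoint Galois closures**: for
`X ~ ⨁ A_i`, `Y ~ ⨁ A'_j` (realisations of CM types of `K_i`, `K'_j`) with
`(∏_i K_i^{gal}) ∩ (∏_j K'_j^{gal}) = ℚ` inside `ℂ`, HC(`X`) and HC(`Y`) imply HC(`X × Y`).  Instances: a CM abelian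
variety (or a Weil-type CM product on which HC is known) times any product of CM abelian varieties with CM by fields
whose Galois closure meets the first one trivially. [cite: MoonenZarhin1999LowDim, §3 (3.1)] [cite: Lang2002, VI §1 Thm. 1.14] -/
theorem hodgeConjectureFor_prod_of_isIsogenous_biproduct_of_normalClosure_inf_eq_bot
    (hA : ∀ i, IsCMTypeRealisation (Φ i) (A i) (ι i) (θ i))
    (hA' : ∀ j, IsCMTypeRealisation (Φ' j) (A' j) (ι' j) (θ' j))
    (H : (⨆ i, IntermediateField.normalClosure ℚ (K i) ℂ) ⊓ (⨆ j, IntermediateField.normalClosure ℚ (K' j) ℂ) = ⊥)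
    {X Y : AbelianVariety ℂ} (hXi : AbelianVariety.IsIsogenous X (⨁ A))
    (hYi : AbelianVariety.IsIsogenous Y (⨁ A')) (hHX : HodgeConjectureFor X.dim X.X)
    (hHY : HodgeConjectureFor Y.dim Y.X) : HodgeConjectureFor (X.prod Y).dim (X.prod Y).X :=
  hodgeConjectureFor_prod_of_isIsogenous_biproduct hA hA' (blockwiseIndependent_of_normalClosure_inf_eq_bot H)
    hXi hYi hHX hHY

end Consequences

end Literature.AlgebraicGeometry.Pohlmann1968

end
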